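import Mathlib.Analysis.Normed.Module.Connected
import Literature.Geometry.Lorentzian.KerrData
import HarnessLib

/-!
# The Kerr–Schild chart domains and slices are connected (discharges of
# `Kerr.isConnected_region` and `Kerr.isConnected_slice`)

(trunk G08 = T-LORENTZ; family `gr`; namespace `Literature.Lorentz.Kerr`)

This file discharges the two topological named facts on which the bundled Kerr spacetime and
Kerr initial data depend (D-0014; the facts stay `def`s, their users can now be fed the proofs):

* `Kerr.isConnected_slice_holds : Kerr.isConnected_slice a r₀` (a field of `Kerr.SliceFacts`,
  `KerrData.lean`): the slice `{y ∈ E3 | r(0, y) > max r₀ 0}` is connected, **for all** `a, r₀`;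
* `Kerr.isConnected_region_holds : Kerr.isConnected_region a r₀` (a field of `Kerr.Facts`,
  `KerrSchild.lean`; together with `Kerr.contMDiff_bilin_holds`, `Kerr.contMDiff_timeVector_holds`
  of `KerrSchildCoord.lean` every field of `Kerr.Facts` is now a theorem): the chart domain
  `Kerr.region a r₀ = {r > max r₀ 0} ⊆ E4` is connected.

Proof (O'Neill 1995, Ch. 2, §2.1: the level sets `{r = c}`, `c > 0`, of the Kerr–Schild radius are
the confocal ellipsoids `(x² + y²)/(c² + a²) + z²/c² = 1`; Visser arXiv:0706.0622, (35)): the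
**oblate spheroidal parametrisation** `(r, ω) ↦ (√(r² + a²) ω₁, √(r² + a²) ω₂, r ω₃)` maps
`(m, ∞) × S²` (connected: `S² ⊆ ℝ³` is connected, Mathlib `isConnected_sphere`) continuously
**onto** the slice `{r(0, ·) > m}`, `m = max r₀ 0 ≥ 0`: the image point has Kerr–Schild radius
exactly `r` (`Kerr.radius_eq_of_quartic`: a positive root of the defining quartic is the radius),
and conversely `y = Φ(r, ω)` with `ω = (y₁/√(r² + a²), y₂/√(r² + a²), y₃/r) ∈ S²` by the quartic
(`(y₁² + y₂²)/(r² + a²) + y₃²/r² = 1`, the nullity of the Kerr–Schild covector). The region is the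
image of `ℝ × slice` under `(t, y) ↦ (t, y)` (the radius does not depend on `t*`).

## References

* B. O'Neill, *The geometry of Kerr black holes*, A K Peters 1995, Ch. 2, §2.1 (key `ONeill1995`).
* M. Visser, *The Kerr spacetime: a brief introduction*, arXiv:0706.0622, (35) (key
  `arXiv07060622`).
* M. Dafermos, I. Rodnianski, *Lectures on black holes and linear waves*, arXiv:0811.0354, §5.1
  (key `arXiv08110354`).
-/

noncomputable section

open Set Metric

namespace Literature.Geometry.Lorentzian.Kerr

/-! ### A positive root of the defining quartic is the Kerr–Schild radius -/

/-- **Uniqueness of the Kerr–Schild radius**: if `r > 0` satisfies the defining quartic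
`r⁴ − (ρ² − a²) r² − a² z² = 0` at `x` (`ρ = ‖x⃗‖`, `z = x₃`), then `r = r(a, x)`. Indeed
`(2r² − (ρ² − a²))² = (ρ² − a²)² + 4a²z²`, and the negative square root would force `r² ≤ 0`.
Visser arXiv:0706.0622, (35). [cite: arXiv07060622, (35)] -/
theorem radius_eq_of_quartic {a r : ℝ} {x : E4} (hr : 0 < r)
    (hq : r ^ 4 - (E4.spatialNorm x ^ 2 - a ^ 2) * r ^ 2 - a ^ 2 * x 3 ^ 2 = 0) :
    radius a x = r := by
  set b : ℝ := E4.spatialNorm x ^ 2 - a ^ 2 with hb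
  set D : ℝ := b ^ 2 + 4 * a ^ 2 * x 3 ^ 2 with hD
  have hD0 : 0 ≤ D := by positivity
  have hsq : (2 * r ^ 2 - b) ^ 2 = D := by
    rw [hD]
    linear_combination 4 * hq
  have habs : |2 * r ^ 2 - b| = √D := by
    rw [← Real.sqrt_sq_eq_abs, hsq]
  have hle : |b| ≤ √D := abs_le_sqrt_radius_discr a x
  -- the sign: `2r² − b = +√D`
  have hpos : 2 * r ^ 2 - b = √D := by
    rcases abs_eq (Real.sqrt_nonneg D) |>.1 habs with h | h
    · exact h
    · exfalso
      have h2 : 2 * r ^ 2 ≤ 0 := by linarith [le_abs_self b]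
      nlinarith
  have hr2 : radius a x ^ 2 = r ^ 2 := by
    rw [radius_sq]
    change (b + √D) / 2 = r ^ 2
    linarith
  have h0 := radius_nonneg a x
  nlinarith [sq_nonneg (radius a x - r), sq_nonneg (radius a x + r)]

/-! ### The oblate spheroidal parametrisation of the slices -/

/-- The point `Φ(r, ω) = (√(r² + a²) ω₁, √(r² + a²) ω₂, r ω₃) ∈ E3` of the oblate spheroidal
parametrisation has Kerr–Schild radius `r`, for `r > 0` and `ω` a Euclidean unit vector
(O'Neill 1995, Ch. 2, §2.1: `{r = c}` is the ellipsoid `(x² + y²)/(c² + a²) + z²/c² = 1`). [cite: ONeill1995, Ch. 2 §2.1] -/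
theorem radius_spheroidal {a r : ℝ} (hr : 0 < r) {ω : E3} (hω : ‖ω‖ = 1) :
    radius a (E4.ofTimeSpace 0
      (WithLp.toLp 2 ![√(r ^ 2 + a ^ 2) * ω 0, √(r ^ 2 + a ^ 2) * ω 1, r * ω 2])) = r := by
  apply radius_eq_of_quartic hr
  have hω2 : ω 0 ^ 2 + ω 1 ^ 2 + ω 2 ^ 2 = 1 := by
    have h := hω
    rw [EuclideanSpace.norm_eq, Real.sqrt_eq_one, Fin.sum_univ_three] at h
    simp only [Real.norm_eq_abs, sq_abs] at h
    exact h
  have hs : √(r ^ 2 + a ^ 2) ^ 2 = r ^ 2 + a ^ 2 := Real.sq_sqrt (by positivity)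
  rw [E4.spatialNorm_ofTimeSpace, EuclideanSpace.norm_eq, Real.sq_sqrt
    (Finset.sum_nonneg fun i _ ↦ by positivity), Fin.sum_univ_three]
  have h3 : (E4.ofTimeSpace 0
      (WithLp.toLp 2 ![√(r ^ 2 + a ^ 2) * ω 0, √(r ^ 2 + a ^ 2) * ω 1, r * ω 2]) : E4) 3 =
        r * ω 2 :=
    E4.ofTimeSpace_apply_succ 0 _ 2
  rw [h3]
  simp only [Matrix.cons_val_zero, Matrix.cons_val_one, Matrix.cons_val, Real.norm_eq_abs, sq_abs]
  rw [mul_pow, mul_pow, mul_pow, hs]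
  linear_combination (-(r ^ 2 * (r ^ 2 + a ^ 2))) * hω2

/-- **The slice `{r(0, ·) > m}` (`m ≥ 0`) is the image of `(m, ∞) × S²` under the oblate
spheroidal parametrisation** `(r, ω) ↦ (√(r² + a²) ω₁, √(r² + a²) ω₂, r ω₃)`; the inverse on
the slice is `ω = (y₁/√(r² + a²), y₂/√(r² + a²), y₃/r)`, a unit vector by the defining quartic.
O'Neill 1995, Ch. 2, §2.1; Visser arXiv:0706.0622, (35). [cite: ONeill1995, Ch. 2 §2.1] -/
theorem slice_eq_image_spheroidal (a : ℝ) {m : ℝ} (hm : 0 ≤ m) :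
    {y : E3 | m < radius a (E4.ofTimeSpace 0 y)} =
      (fun p : ℝ × E3 ↦ (WithLp.toLp 2
        ![√(p.1 ^ 2 + a ^ 2) * p.2 0, √(p.1 ^ 2 + a ^ 2) * p.2 1, p.1 * p.2 2] : E3)) ''
        (Ioi m ×ˢ sphere (0 : E3) 1) := by
  ext y
  simp only [mem_setOf_eq, mem_image, mem_prod, mem_Ioi, mem_sphere_iff_norm, sub_zero,
    Prod.exists]
  constructor
  · intro hy
    set r := radius a (E4.ofTimeSpace 0 y) with hr
    have hr0 : 0 < r := hm.trans_lt hy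
    have hra : 0 < r ^ 2 + a ^ 2 := by positivity
    set c := √(r ^ 2 + a ^ 2) with hc
    have hc0 : 0 < c := Real.sqrt_pos.2 hra
    have hcsq : c ^ 2 = r ^ 2 + a ^ 2 := Real.sq_sqrt hra.le
    have hq : r ^ 4 - (‖y‖ ^ 2 - a ^ 2) * r ^ 2 - a ^ 2 * y 2 ^ 2 = 0 := by
      have h := radius_quartic a (E4.ofTimeSpace 0 y)
      have h3 : (E4.ofTimeSpace 0 y) 3 = y 2 := E4.ofTimeSpace_apply_succ 0 y 2
      rwa [E4.spatialNorm_ofTimeSpace, h3] at h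
    have hny : ‖y‖ ^ 2 = y 0 ^ 2 + y 1 ^ 2 + y 2 ^ 2 := by
      rw [EuclideanSpace.real_norm_sq_eq]
      simp [Fin.sum_univ_three]
    rw [hny] at hq
    refine ⟨r, WithLp.toLp 2 ![y 0 / c, y 1 / c, y 2 / r], ⟨hy, ?_⟩, ?_⟩
    · -- `ω` is a unit vector
      rw [EuclideanSpace.norm_eq, Real.sqrt_eq_one, Fin.sum_univ_three]
      simp only [Matrix.cons_val_zero, Matrix.cons_val_one, Matrix.cons_val, Real.norm_eq_abs,
        sq_abs]
      rw [div_pow, div_pow, div_pow, hcsq]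
      field_simp
      linear_combination (-1 : ℝ) * hq
    · -- `Φ(r, ω) = y`
      ext i
      fin_cases i
      · simp only [Matrix.cons_val_zero]
        change c * (y 0 / c) = y 0
        field_simp
      · simp only [Matrix.cons_val_one, Matrix.cons_val_zero]
        change c * (y 1 / c) = y 1
        field_simp
      · simp only [Matrix.cons_val]
        change r * (y 2 / r) = y 2
        field_simp
  · rintro ⟨r, ω, ⟨hr, hω⟩, rfl⟩
    rw [radius_spheroidal (hm.trans_lt hr) hω]
    exact hr

/-- The oblate spheroidal parametrisation is continuous. [folklore] -/
theorem continuous_spheroidal (a : ℝ) :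
    Continuous fun p : ℝ × E3 ↦ (WithLp.toLp 2
      ![√(p.1 ^ 2 + a ^ 2) * p.2 0, √(p.1 ^ 2 + a ^ 2) * p.2 1, p.1 * p.2 2] : E3) := by
  refine (PiLp.continuous_toLp 2 _).comp ?_
  refine continuous_pi fun i ↦ ?_
  have h0 : Continuous fun p : ℝ × E3 ↦ p.2 0 := (PiLp.continuous_apply 2 _ 0).comp continuous_snd
  have h1 : Continuous fun p : ℝ × E3 ↦ p.2 1 := (PiLp.continuous_apply 2 _ 1).comp continuous_snd
  have h2 : Continuous fun p : ℝ × E3 ↦ p.2 2 := (PiLp.continuous_apply 2 _ 2).comp continuous_snd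
  have hs : Continuous fun p : ℝ × E3 ↦ √(p.1 ^ 2 + a ^ 2) :=
    ((continuous_fst.pow 2).add continuous_const).sqrt
  fin_cases i
  · simp only [Fin.zero_eta, Fin.isValue, Matrix.cons_val_zero]
    exact hs.mul h0
  · simp only [Fin.mk_one, Fin.isValue, Matrix.cons_val_one, Matrix.cons_val_zero]
    exact hs.mul h1
  · simp only [Fin.reduceFinMk, Matrix.cons_val]
    exact continuous_fst.mul h2

/-- `S² ⊆ ℝ³` is connected (Mathlib `isConnected_sphere`, `dim ℝ³ = 3 > 1`). [folklore] -/
theorem isConnected_sphere_E3 : IsConnected (sphere (0 : E3) 1) := by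
  refine isConnected_sphere ?_ (0 : E3) zero_le_one
  rw [← Module.finrank_eq_rank, finrank_euclideanSpace_fin]
  norm_num

/-- **The slices `{r(0, ·) > m}`, `m ≥ 0`, are connected**: continuous images of the connected
set `(m, ∞) × S²`. O'Neill 1995, Ch. 2, §2.1. [cite: ONeill1995, Ch. 2 §2.1] -/
theorem isConnected_setOf_lt_radius (a : ℝ) {m : ℝ} (hm : 0 ≤ m) :
    IsConnected {y : E3 | m < radius a (E4.ofTimeSpace 0 y)} := by
  rw [slice_eq_image_spheroidal a hm]
  exact (isConnected_Ioi.prod isConnected_sphere_E3).image _ (continuous_spheroidal a).continuousOn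

/-- **Discharge of the named fact `Kerr.isConnected_slice`** (a field of `Kerr.SliceFacts`):
`Kerr.slice a r₀ = {y | max r₀ 0 < r(0, y)}` is connected for all `a, r₀` — the exterior of a
confocal ellipsoid (`max r₀ 0 > 0`) or the complement of the disc `{z = 0, ρ ≤ |a|}`
(`max r₀ 0 = 0`), in both cases the image of `(max r₀ 0, ∞) × S²` under the oblate spheroidal
parametrisation. O'Neill 1995, Ch. 2, §2.1; Dafermos–Rodnianski arXiv:0811.0354, §5.1. [cite: ONeill1995, Ch. 2 §2.1] -/
theorem isConnected_slice_holds (a r₀ : ℝ) : isConnected_slice a r₀ :=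
  isConnected_setOf_lt_radius a (le_max_right r₀ 0)

/-- **Discharge of the named fact `Kerr.isConnected_region`** (a field of `Kerr.Facts`): the chart
domain `Kerr.region a r₀ = {x ∈ E4 | max r₀ 0 < r(a, x)}` is connected for all `a, r₀`, being the
image of `ℝ × Kerr.slice a r₀` under `(t, y) ↦ (t, y)` (the Kerr–Schild radius does not depend on
`t*`). O'Neill 1995, Ch. 2, §2.1; Dafermos–Rodnianski arXiv:0811.0354, §5.1. [cite: ONeill1995, Ch. 2 §2.1] -/
theorem isConnected_region_holds (a r₀ : ℝ) : isConnected_region a r₀ := by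
  have hcont : Continuous fun p : ℝ × E3 ↦ E4.ofTimeSpace p.1 p.2 := by
    refine (PiLp.continuous_toLp 2 _).comp ?_
    refine continuous_pi fun i ↦ ?_
    refine Fin.cases ?_ (fun j ↦ ?_) i
    · simpa using continuous_fst
    · simpa [Function.comp_def] using (PiLp.continuous_apply 2 _ j).comp continuous_snd
  have heq : (region a r₀ : Set E4) =
      (fun p : ℝ × E3 ↦ E4.ofTimeSpace p.1 p.2) '' (univ ×ˢ (slice a r₀ : Set E3)) := by
    ext x
    simp only [SetLike.mem_coe, mem_region, mem_image, mem_prod, mem_univ, true_and,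
      Prod.exists]
    constructor
    · intro hx
      refine ⟨E4.time x, E4.spatial x, ?_, E4.ofTimeSpace_time_spatial x⟩
      change max r₀ 0 < radius a (E4.ofTimeSpace 0 (E4.spatial x))
      have h3 : (E4.ofTimeSpace 0 (E4.spatial x)) 3 = x 3 := E4.ofTimeSpace_apply_succ 0 _ 2
      have : radius a (E4.ofTimeSpace 0 (E4.spatial x)) = radius a x := by
        simp only [radius, E4.spatialNorm_ofTimeSpace, h3]
        rfl
      rwa [this]
    · rintro ⟨t, y, hy, rfl⟩
      have h3 : (E4.ofTimeSpace t y) 3 = (E4.ofTimeSpace 0 y) 3 := by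
        rw [show (3 : Fin 4) = Fin.succ 2 from rfl, E4.ofTimeSpace_apply_succ,
          E4.ofTimeSpace_apply_succ]
      have : radius a (E4.ofTimeSpace t y) = radius a (E4.ofTimeSpace 0 y) := by
        simp only [radius, E4.spatialNorm_ofTimeSpace, h3]
      rw [this]
      exact hy
  change IsConnected (region a r₀ : Set E4)
  rw [heq]
  exact (isConnected_univ.prod (isConnected_slice_holds a r₀)).image _ hcont.continuousOn

/-- The `ConnectedSpace` instance of the chart domains, now unconditionally (cf.
`Kerr.connectedSpace_region`, which takes it from `[Kerr.Facts]`). O'Neill 1995, Ch. 2, §2.1. [cite: ONeill1995, Ch. 2 §2.1] -/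
theorem connectedSpace_region' (a r₀ : ℝ) : ConnectedSpace (region a r₀) :=
  isConnected_iff_connectedSpace.mp (isConnected_region_holds a r₀)

end Literature.Geometry.Lorentzian.Kerr

end
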